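import Summits.AtomisticToContinuum.HydrodynamicLimit.Theorems.AntiMazurCoboundariesInfluenceLocalityObjects

/-!
# Stub `stub_forecastWorldsGood` of the line `true-anchored-infection`
# (crux `InfluenceLocality`, stmt-AtomisticToContinuum-13916; route AntiMazurCoboundaries)

STUB 1 (null sets) of the registered skeleton: `G_N`-almost every datum `z` is good for the true
flow `Φ`, AND every one of its `N + 1` range clusters `S = rangeCluster G3 (Rℓ) z i` restricts
(`Config.restrictTo S z`) to a good datum of the cluster flow `Ψ S.card` — so the forecast worlds
of the line are genuine hard-sphere trajectories.

Proof (no dynamics is computed):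

* `G_N = Liouville.withDensity ρ ≪ Liouville = vol|_{D_{N+1}}` (`particleLaw_eq`,
  `liouville_eq`);
* `Φ.goodᶜ` is Liouville-null (`HardSphereFlow.ae_mem_good`);
* for a FIXED label set `S`, the coordinate projection `Config.restrictTo S` pulls Lebesgue-null
  sets back to Lebesgue-null sets (`volume_restrictTo_preimage_null_torus`, the torus twin of
  `CellForecastPressureDecay.volume_restrictTo_preimage_null`: split the labels as
  `Fin S.card ⊕ Fin Sᶜ.card ≃ Fin n`, the restriction is the first component of the
  measure-preserving splitting `sumPiEquivProdPi ∘ piCongrLeft⁻¹`, and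
  `(vol ⊗ vol)(B × univ) = 0 · vol(univ) = 0`); a sub-configuration of a hard-sphere
  configuration is a hard-sphere configuration and `D_{S.card} ∖ (Ψ S.card).good` is
  Lebesgue-null (`HardSphereFlow.measure_compl_good`), so Liouville-a.e. `Config.restrictTo S z`
  is good (`ae_liouville_restrictTo_mem_good`);
* the countable intersection over ALL `S : Finset (Fin (N + 1))` (`ae_all_iff`) covers the
  configuration-dependent range clusters, so no measurability of the cluster map is needed.

The positivity hypotheses of the statement are not used.
-/

namespace Summit.AtomisticToContinuum.HydrodynamicLimit.Theorems.TrueAnchoredInfection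

open MeasureTheory Set Filter
open scoped ENNReal
open Literature.Analysis.FluidPDE Literature.MathematicalPhysics.KineticTheory

noncomputable section

variable {n : ℕ}

/-- Sub-configurations of hard-sphere configurations are hard-sphere configurations (the
relabelling `S.orderEmbOfFin` is injective). -/
private theorem restrictTo_mem_hardSphereDomain' {d : Type*} [Fintype d] {X : Type*}
    {G : Geometry d X} {ε : ℝ} (S : Finset (Fin n)) {z : Config n d X}
    (hz : z ∈ hardSphereDomain G n ε) :
    Config.restrictTo S z ∈ hardSphereDomain G S.card ε := by
  rw [mem_hardSphereDomain] at hz ⊢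
  intro i j hij
  simp only [Config.restrictTo_apply]
  exact hz _ _ fun h => hij ((S.orderEmbOfFin rfl).injective h)

/-- **Coordinate projections pull null sets back to null sets** (positions on the torus `𝕋³`):
for a Lebesgue-null measurable `B ⊆ Config S.card (Fin 3) T3`, the configurations of `n`
particles whose restriction to `S` lies in `B` form a Lebesgue-null set. Split the labels as
`Fin S.card ⊕ Fin Sᶜ.card ≃ Fin n`, `inl m ↦ S.orderEmbOfFin m`; the restriction is then the
first component of the measure-preserving splitting `sumPiEquivProdPi ∘ piCongrLeft⁻¹`, and
`(vol ⊗ vol)(B × univ) = 0 · vol(univ) = 0`. Torus twin of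
`CellForecastPressureDecay.volume_restrictTo_preimage_null` (Euclidean positions). -/
theorem volume_restrictTo_preimage_null_torus (S : Finset (Fin n))
    {B : Set (Config S.card (Fin 3) T3)} (hBm : MeasurableSet B) (hB : volume B = 0) :
    volume {z : Config n (Fin 3) T3 | Config.restrictTo S z ∈ B} = 0 := by
  -- adapted from CellForecastPressureDecay.volume_restrictTo_preimage_null (FlowIndependence.lean)
  -- σ-finiteness of the one-particle phase space, as a CLOSED local instance (the `∀ i`
  -- forms needed by `Measure.pi` are then found from it; direct search fails on them)
  haveI hY : SigmaFinite (volume : Measure (T3 × V3)) := inferInstance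
  -- index equivalence `Fin S.card ⊕ Fin Sᶜ.card ≃ Fin n`, `inl m ↦ S.orderEmbOfFin m`
  let e : Fin S.card ⊕ Fin Sᶜ.card ≃ Fin n :=
    (Equiv.sumCongr (S.orderIsoOfFin rfl).toEquiv
      ((Sᶜ.orderIsoOfFin rfl).toEquiv.trans
        (Equiv.subtypeEquivRight (fun i => by simp [Finset.mem_compl])))).trans
      (Equiv.sumCompl fun i => i ∈ S)
  have he : ∀ m : Fin S.card, e (Sum.inl m) = S.orderEmbOfFin rfl m := by
    intro m
    simp only [e, Equiv.trans_apply, Equiv.sumCongr_apply, Sum.map_inl, Equiv.sumCompl_apply_inl]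
    rfl
  let E := MeasurableEquiv.piCongrLeft (fun _ : Fin n => T3 × V3) e
  have hE := measurePreserving_piCongrLeft (fun _ : Fin n => (volume : Measure (T3 × V3))) e
  let F := MeasurableEquiv.sumPiEquivProdPi (fun _ : Fin S.card ⊕ Fin Sᶜ.card => T3 × V3)
  have hF := measurePreserving_sumPiEquivProdPi
    (fun _ : Fin S.card ⊕ Fin Sᶜ.card => (volume : Measure (T3 × V3)))
  have hG : MeasurePreserving (F ∘ E.symm)
      (Measure.pi fun _ : Fin n => (volume : Measure (T3 × V3)))
      ((Measure.pi fun _ : Fin S.card => (volume : Measure (T3 × V3))).prod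
        (Measure.pi fun _ : Fin Sᶜ.card => (volume : Measure (T3 × V3)))) :=
    hF.comp hE.symm
  have hfac : ∀ z : Config n (Fin 3) T3, (F (E.symm z)).1 = Config.restrictTo S z := by
    intro z
    funext m
    rw [Config.restrictTo_apply, ← he]
    rfl
  have hset : {z : Config n (Fin 3) T3 | Config.restrictTo S z ∈ B} =
      (F ∘ E.symm) ⁻¹' (B ×ˢ univ) := by
    ext z
    simp only [mem_setOf_eq, mem_preimage, Function.comp_apply, mem_prod, mem_univ, and_true, hfac]
  haveI : SigmaFinite (Measure.pi fun _ : Fin Sᶜ.card => (volume : Measure (T3 × V3))) :=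
    Measure.pi.sigmaFinite _
  rw [hset, volume_pi, hG.measure_preimage (hBm.prod MeasurableSet.univ).nullMeasurableSet,
    Measure.prod_prod, ← volume_pi, hB, zero_mul]

/-- **Liouville-almost surely every sub-configuration is a good datum of the cluster flow**
(torus, `n` spheres of diameter `ε`, any family `Ψ` of cluster flows of the same diameter):
for each fixed `S` the bad event lies, inside the hard-sphere domain, in the preimage under
`Config.restrictTo S` of the Lebesgue-null set `D_{S.card} ∖ (Ψ S.card).good`; countable
intersection over `S`. -/
theorem ae_liouville_restrictTo_mem_good {ε : ℝ} (Ψ : (k : ℕ) → HardSphereFlow G3 ε k) :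
    ∀ᵐ z ∂(liouville G3 n ε),
      ∀ S : Finset (Fin n), Config.restrictTo S z ∈ (Ψ S.card).good := by
  rw [liouville_eq, ae_all_iff]
  intro S
  -- the null set `D_{S.card} \ good` downstairs
  have hDkm : MeasurableSet (hardSphereDomain G3 S.card ε) :=
    measurableSet_hardSphereDomain _ Torus.measurable_geometry_sepVec _ ε
  have hBm : MeasurableSet (hardSphereDomain G3 S.card ε \ (Ψ S.card).good) :=
    hDkm.diff (Ψ S.card).measurableSet_good
  have hB : volume (hardSphereDomain G3 S.card ε \ (Ψ S.card).good) = 0 := by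
    have h := (Ψ S.card).measure_compl_good
    rw [liouville_eq, Measure.restrict_apply (Ψ S.card).measurableSet_good.compl] at h
    rwa [sdiff_eq_compl_inter]
  have h0 := volume_restrictTo_preimage_null_torus S hBm hB
  rw [ae_restrict_iff' (measurableSet_hardSphereDomain _ Torus.measurable_geometry_sepVec n ε),
    ae_iff]
  refine measure_mono_null (fun z hz => ?_) h0
  simp only [mem_setOf_eq, Classical.not_imp] at hz
  exact ⟨restrictTo_mem_hardSphereDomain' S hz.1, hz.2⟩

/-- `G_N ≪ Liouville`: the Gibbs law of the crux is `liouville.withDensity` of the canonical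
density (`particleLaw_eq`). -/
theorem gibbs_absolutelyContinuous (σ a θ : ℝ) (u₀ : V3) (N : ℕ) (Φ : Flow σ N) :
    gibbs σ a θ u₀ N Φ ≪ liouville G3 (N + 1) (hsDiameter σ N) := by
  unfold gibbs Literature.MathematicalPhysics.KineticTheory.localGibbsLaw
  rw [particleLaw_eq]
  exact withDensity_absolutelyContinuous _ _

/-- `G_N`-almost surely the datum is good for `Φ` and ALL its sub-configurations are good data
of the cluster flows `Ψ k` (the `S`-uniform form of the stub, from which it follows by
specialising `S` to the range clusters). -/
theorem ae_gibbs_mem_good_and_restrictTo_mem_good (σ a θ : ℝ) (u₀ : V3) (N : ℕ)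
    (Φ : Flow σ N) (Ψ : ClusterFlows σ N) :
    ∀ᵐ z ∂(gibbs σ a θ u₀ N Φ), z ∈ Φ.good ∧
      ∀ S : Finset (Fin (N + 1)), Config.restrictTo S z ∈ (Ψ S.card).good :=
  (gibbs_absolutelyContinuous σ a θ u₀ N Φ).ae_le
    (Φ.ae_mem_good.and (ae_liouville_restrictTo_mem_good Ψ))

/-- **Registered stub `stub_forecastWorldsGood`** (STUB 1 of the line `true-anchored-infection`,
crux stmt-AtomisticToContinuum-13916): `G_N`-almost every datum is good for the true flow and
every one of its `N + 1` range clusters restricts to a good datum of the cluster flow. -/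
theorem stub_forecastWorldsGood : ForecastWorldsGood := by
  intro σ a θ u₀ N Φ Ψ R _ _ _ _
  filter_upwards [ae_gibbs_mem_good_and_restrictTo_mem_good σ a θ u₀ N Φ Ψ] with z hz
  exact ⟨hz.1, fun i => hz.2 _⟩

end

end Summit.AtomisticToContinuum.HydrodynamicLimit.Theorems.TrueAnchoredInfection
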